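import Summits.BirchSwinnertonDyer.BirchSwinnertonDyer.Theorems.GenusKolyvaginAtTwoPowDvdShaCardAtTwoRTOrderFourAuxiliaryConstrained
import Summits.BirchSwinnertonDyer.BirchSwinnertonDyer.Theorems.GenusKolyvaginAtTwoEquivariantKolyvaginExactAtTwoFrobeniusCriterion
import Summits.BirchSwinnertonDyer.Rank1Residual.X11b.KummerPoitouTateExact
import Literature.NumberTheory.EllipticCurves.SelmerLocalConditionGoodReductionProofs
import Literature.NumberTheory.EllipticCurves.CasselsTateSelmerKolyvaginValue
import Literature.NumberTheory.EllipticCurves.HeegnerPointsKolyvaginProp81FrobeniusProofs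
import Literature.NumberTheory.EllipticCurves.HeegnerPointsKolyvaginPrimaryCebotarevProofs
import Literature.NumberTheory.EllipticCurves.SelmerCorankControlRatProofs
import HarnessLib

/-!
# Route `GenusKolyvaginAtTwo`, crux L_T `PowDvdShaCardAtTwoRT` (stmt-BirchSwinnertonDyer-23242), LINE 18 stub L, bottom rung:
# THE LOCAL CONDITION AT A DEEP OWN PRIME, AS AN ∃-THEOREM — `∃ M_ℓ ≤ H¹(ℚ_ℓ, E[4])` with `8 ≤ #M_ℓ` killing
# `⟨loc_ℓ(2•Z), ·⟩` for every global `Z` with `2•Z` TRANSVERSE at `ℓ`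

Width seat `bsd-line-gk2-p4` g18 (cell `bsd-f1-sign2`), `--supports 23242 --as helper`.  THEOREMS ONLY (no definition, no named
fact, no `sorry`; standard axioms).  BSD is NOT proved by any of this; neither is the crux nor stub L.

WHY (LEAD memo `Cruxes/PowDvdShaCardAtTwoRT/Lines/plus-descent-lead-g16.md` §2, §7 (i), §8).  The bottom-rung engine for index-≥2
witnesses needs, at every DEEP own prime `ℓ ∈ t` of the `k`-minimal witness, a local condition `M_ℓ ≤ H¹(ℚ_ℓ, A)` (`A = E^ε[4]`)
with (1) `#M_ℓ ≥ 8` (the numerical input of `…RTOrderFourAuxiliaryConstrained.exists_mem_kummerOutside_four_two_nsmul_ne_zero_of_free_of_eight_le`)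
and (2) `⟨X_ℓ, y_ℓ⟩ = 0` for `y_ℓ ∈ M_ℓ` and `X = 2•Z`, `Z = desc c₂(nℓ′)` the (later chosen) Kolyvagin class, whose own-prime
localisation has «`2 ×` unramified part `= 0`» — i.e. `2•Z` is TRANSVERSE at `ℓ` in the currency of gk2-p3's I7
(`[2•Z, F] ∈ (F − 1)A` for an arithmetic Frobenius `F` at the prime of the chosen embedding).  The memo's `M_ℓ = H¹_tr ⊕ H¹_f[2]`
would need the transverse subgroup `H¹_tr(ℚ_ℓ, A)` typed as a LOCAL subgroup of order `4` (not in the tree at `p = 2` over `ℚ_ℓ`: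
the Howard2004/Mazur–Rubin transverse conditions assume trivial local action).  THIS FILE AVOIDS IT: take
**`M_ℓ := (loc_ℓ 𝒯₂)^⊥`**, the annihilator (for `inv_ℓ(· ∪ₑ ·)`) of `X_ℓ := loc_ℓ(𝒯) ⊓ 2•H¹(ℚ_ℓ, A)`, `𝒯 ≤ H¹(ℚ, A)` the
subgroup of classes transverse at `ℓ` (w.r.t. the fixed `F`).  Then (2) holds BY DEFINITION for every `Z` with `2•Z ∈ 𝒯`, and
(1) is **`#X_ℓ ≤ 2`**, proved WITHOUT any transverse supply and WITHOUT the exact local structure: `X_ℓ ⊓ 𝓛_ℓ = ⊥` (a transverse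
class that is Kummer at `ℓ` is unramified there — `selmerLocalKer_eq_unramifiedKer` — hence LOCALLY ZERO by the Frobenius criterion
`mem_torsionLocalKer_iff_exists_h1Eval_eq_smul_sub`), `2•H¹(ℚ_ℓ, A)` is isotropic hence of order `≤ 4` when `#H¹(ℚ_ℓ, A) ≤ 16`,
and EITHER `𝓛_ℓ` has an element `f` with `2f ≠ 0` (then `{0, 2f} ≤ 2•H¹ ⊓ 𝓛_ℓ` meets `X_ℓ` trivially, so `#X_ℓ · 2 ≤ 4`) OR
`2•𝓛_ℓ = 0` (then `2•H¹ ≤ 𝓛_ℓ^⊥ = 𝓛_ℓ` by Tate duality `annRight_invWeilPairing_kummer_eq`, so `X_ℓ ≤ 𝓛_ℓ`, `X_ℓ = ⊥`).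
Finally `#M_ℓ · #X_ℓ = #H¹(ℚ_ℓ, A) = 16` (`natCard_annRight_mul`).
* §1 (any number field `K`, any `E/K`, any level `n`, any Frobenius `F` at the prime of the chosen embedding over a good `v ∤ n`):
  `exists_h1Eval_add_eq` (the chosen cocycle of `x + y` vs the sum, up to a coboundary value), `transverse_add/zero/neg`,
  **`localization_eq_zero_of_transverse_of_mem_kummer`** (transverse ∧ Kummer at `v` ⟹ `loc_v = 0`).
* §2 (level `4`, any `K`): **`exists_localCondition_eight_le_of_frobenius`** — `#H¹(K_v, E[4]) = 16`, `inv_v` injective ⟹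
  `∃ M ≤ H¹(K_v, E[4])`, `8 ≤ #M`, `∀ Z, (2•Z transverse at v w.r.t. F) → ∀ m ∈ M, inv_v(loc_v(2•Z) ∪ₑ m) = 0`.
* §3 (over `ℚ`, `Δ < 0`, a Gross–Kolyvagin prime `ℓ ≠ 2` of good reduction with `Frob_ℓ = Frob_∞` on `E[2]` and `kolyvaginIndex ≥ 2`,
  the hypotheses of the S-bot socket): **`exists_localCondition_eight_le_rat`** (`#H¹ = 16` discharged by the LEAD's
  `natCard_galoisCohomology_one_toLocal_two_pow_eq`; `F` supplied by `FrobEqFrobInfty.exists_at`), and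
  **`exists_localCondition_eight_le_forall`** — the same with the transversality hypothesis in gk2-p3's `∀ 𝔓 ∀ F ∀ c₀` form at
  level `4` (needs `FrobEqFrobInfty W K 4 ℓ`).
HONEST FRAMING: Poitou–Tate/Tate-duality bookkeeping over tree theorems; the arithmetic input «`2•Z` transverse at the deep own
primes» (gk2-p3 `…RTKolyvaginValuesLine` + `…EigenNorms`, LEAD memo §8) is NOT proved here; closes nothing.  BSD is NOT proved.

References: [McCallumLMS1991] §2 Prop. 2.1, §3 (3), §5 Lemma 5.3 and proof of Prop. 5.2 (13); [GrossLMS1991] §7 (7.1), Prop. 9.6;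
[MilneADT2006] Ch. I Cor. 2.3, Cor. 3.4, Lemma 6.15, Thm. 2.8.
-/

set_option autoImplicit false
-- the Theorems namespace of this sub repeats the summit name by design (D-0017 nested layout)
set_option linter.dupNamespace false

noncomputable section

open scoped Classical

open CategoryTheory Field NumberField IsDedekindDomain Function
open _root_.WeierstrassCurve
open Literature.NumberTheory.EllipticCurves
open Literature.NumberTheory.GaloisRepresentations
open Literature.NumberTheory.GaloisCohomology
open Summit.BirchSwinnertonDyer.Rank1Residual.X11b.KummerPT
open Summit.BirchSwinnertonDyer.Rank1Residual.X11b.FiniteDuality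
open Summit.BirchSwinnertonDyer.Rank1Residual.X11b.Relaxation
open scoped ContRepresentation

namespace Summit.BirchSwinnertonDyer.BirchSwinnertonDyer.Theorems.GenusExact.DeepOwnPrime

open Summit.BirchSwinnertonDyer.BirchSwinnertonDyer.Theorems.GenusExact.FrobeniusCriterion
open Summit.BirchSwinnertonDyer.BirchSwinnertonDyer.Theorems.GenusExact.RelaxedCount

/-! ## §1 Transverse classes at a fixed Frobenius: a subgroup; transverse ∧ Kummer ⟹ locally zero -/

section Transverse

variable {K : Type} [Field K] [NumberField K] (W : WeierstrassCurve K)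

omit [NumberField K] in
/-- **The chosen cocycle of `x + y` at `ρ` differs from the sum of the chosen cocycles by a coboundary value `ρ·b − b`**
(cohomologous cocycles). [folklore] -/
theorem exists_h1Eval_add_eq (n : ℤ) (x y : galH1Torsion W n) (ρ : absoluteGaloisGroup K) :
    ∃ b : geomTorsion W n, h1Eval W n (x + y) ρ = h1Eval W n x ρ + h1Eval W n y ρ + (ρ • b - b) := by
  have h1 : oneCocycleClass _ (reprCocycle W n x + reprCocycle W n y) = x + y := by
    rw [oneCocycleClass_add, oneCocycleClass_reprCocycle, oneCocycleClass_reprCocycle]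
  have h0 : oneCocycleClass _ (reprCocycle W n (x + y) - (reprCocycle W n x + reprCocycle W n y)) = 0 := by
    rw [oneCocycleClass_sub, h1, oneCocycleClass_reprCocycle, sub_self]
  obtain ⟨b, hb⟩ := (oneCocycleClass_eq_zero_iff _ _).mp h0
  refine ⟨b, ?_⟩
  have h := hb ρ
  rw [discreteTopRep_ρ_apply] at h
  change h1Eval W n (x + y) ρ - (h1Eval W n x ρ + h1Eval W n y ρ) = ρ • b - b at h
  rw [← h]
  abel

omit [NumberField K] in
/-- **Transversality at `F` is additive**: `[x, F], [y, F] ∈ (F − 1)E[n] ⟹ [x + y, F] ∈ (F − 1)E[n]`. [folklore] -/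
theorem transverse_add (n : ℤ) {F : absoluteGaloisGroup K} {x y : galH1Torsion W n}
    (hx : ∃ P : geomTorsion W n, h1Eval W n x F = F • P - P) (hy : ∃ P : geomTorsion W n, h1Eval W n y F = F • P - P) :
    ∃ P : geomTorsion W n, h1Eval W n (x + y) F = F • P - P := by
  obtain ⟨P, hP⟩ := hx
  obtain ⟨Q, hQ⟩ := hy
  obtain ⟨b, hb⟩ := exists_h1Eval_add_eq W n x y F
  refine ⟨P + Q + b, ?_⟩
  rw [hb, hP, hQ, smul_add, smul_add]
  abel

omit [NumberField K] in
/-- `[0, F] ∈ (F − 1)E[n]` (the chosen cocycle of the zero class is a coboundary). [folklore] -/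
theorem transverse_zero (n : ℤ) (F : absoluteGaloisGroup K) :
    ∃ P : geomTorsion W n, h1Eval W n (0 : galH1Torsion W n) F = F • P - P := by
  obtain ⟨b, hb⟩ := exists_h1Eval_zsmul_eq W n (0 : galH1Torsion W n) 0 F
  refine ⟨b, ?_⟩
  rw [zero_smul] at hb
  rw [hb, zero_smul, zero_add]

omit [NumberField K] in
/-- **Transversality at `F` passes to `−x`.** [folklore] -/
theorem transverse_neg (n : ℤ) {F : absoluteGaloisGroup K} {x : galH1Torsion W n}
    (hx : ∃ P : geomTorsion W n, h1Eval W n x F = F • P - P) :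
    ∃ P : geomTorsion W n, h1Eval W n (-x) F = F • P - P := by
  obtain ⟨P, hP⟩ := hx
  obtain ⟨b, hb⟩ := exists_h1Eval_zsmul_eq W n x (-1) F
  refine ⟨-P + b, ?_⟩
  rw [neg_one_zsmul] at hb
  rw [hb, hP, smul_add, smul_neg, neg_one_zsmul]
  abel

omit [NumberField K] in
/-- **Transversality at `F` passes to integer multiples.** [folklore] -/
theorem transverse_zsmul (n : ℤ) {F : absoluteGaloisGroup K} {x : galH1Torsion W n}
    (hx : ∃ P : geomTorsion W n, h1Eval W n x F = F • P - P) (c : ℤ) :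
    ∃ P : geomTorsion W n, h1Eval W n (c • x) F = F • P - P := by
  obtain ⟨P, hP⟩ := hx
  obtain ⟨b, hb⟩ := exists_h1Eval_zsmul_eq W n x c F
  refine ⟨c • P + b, ?_⟩
  rw [hb, hP, smul_sub, smul_add, smul_comm c F P]
  abel

variable [W.IsElliptic] {v : HeightOneSpectrum (𝓞 K)}

/-- **Transverse ∧ Kummer at `v` ⟹ locally zero.**  At a finite place `v ∤ n` of good reduction, with `𝔓` the prime of
`\bar ℤ_K` cut out by the chosen embedding `K̄ → K̄_v` (`𝔐 ∈ v.localPrimesAbove`) and `F ∈ Γ_K` an arithmetic Frobenius at `𝔓`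
(no hypothesis on how `F` acts on `E[n]`): a class `x ∈ H¹(K, E[n])` that is TRANSVERSE at `F` (`[x, F] ∈ (F − 1)E[n]`) and
satisfies the Kummer condition at `v` (`loc_v x ∈ 𝓛_v`) has `loc_v x = 0`.  Proof: `𝓛_v` = unramified classes at `𝔓`
(`selmerLocalKer_eq_unramifiedKer`, good `v ∤ n`), and an unramified class with `[x, F] ∈ (F − 1)E[n]` dies at `v`
(`mem_torsionLocalKer_iff_exists_h1Eval_eq_smul_sub`; inertia fixes `E[n]` by good reduction). [cite: GrossLMS1991, §7 (7.1) and Prop. 9.6]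
[cite: McCallumLMS1991, §3 (3)] -/
theorem localization_eq_zero_of_transverse_of_mem_kummer {n : ℕ} (hn0 : n ≠ 0) (hv : W.HasGoodReductionAt v)
    (hnv : ((n : ℤ) : 𝓞 K) ∉ v.asIdeal)
    {𝔐 : Ideal (HeightOneSpectrum.localAbsIntegers v)} (h𝔐 : 𝔐 ∈ v.localPrimesAbove)
    {F : absoluteGaloisGroup K}
    (hF : IsArithFrobAt (𝓞 K) F (v.primeBelow (closureEmb (K := K) (v.adicCompletion K)) 𝔐))
    {x : galH1Torsion W (n : ℤ)} (hx : ∃ P : geomTorsion W (n : ℤ), h1Eval W (n : ℤ) x F = F • P - P)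
    (hxL : galoisCohomology.localization (W.torsionGaloisModule (n : ℤ)) (Sum.inr v) 1 x ∈
      W.kummerSelmerStructure (n : ℤ) (Sum.inr v)) :
    galoisCohomology.localization (W.torsionGaloisModule (n : ℤ)) (Sum.inr v) 1 x = 0 := by
  haveI : CharZero (v.adicCompletion K) := charZero_adicCompletion v
  -- the prime of the chosen embedding
  set 𝔓 := v.primeBelow (closureEmb (K := K) (v.adicCompletion K)) 𝔐 with h𝔓def
  have h𝔓 : 𝔓 ∈ v.primesAbove := HeightOneSpectrum.primeBelow_mem_primesAbove h𝔐
  -- Kummer at `v` = the Selmer local kernel = unramified at `𝔓`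
  have hsel : x ∈ selmerLocalKer W (v.adicCompletion K) (n : ℤ) :=
    mem_selmerLocalKer_of_mem_kummerLocalConditionAt_res W (n : ℤ) (v.adicCompletion K) hxL
  have hunr : x ∈ unramifiedKer (geomTorsion W (n : ℤ)) 𝔓 := by
    rw [← W.selmerLocalKer_eq_unramifiedKer hv hnv h𝔓]; exact hsel
  -- the inputs of the Frobenius criterion
  have hwbad : v ∉ W.badPlaces (𝓞 K) := fun h ↦ h hv
  have hI : 𝔓.inertia (absoluteGaloisGroup K) ≤ torsionFixing W (n : ℤ) :=
    inertia_le_torsionFixing W hwbad hnv _ h𝔐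
  have hn0Z : ((n : ℕ) : ℤ) ≠ 0 := by exact_mod_cast hn0
  have hopen := isOpen_torsionFixing W hn0Z
  have hsurj := (torsionPointsMap_bijective W (v.adicCompletion K) hn0).2
  have htor : x ∈ W.torsionLocalKer (v.adicCompletion K) (n : ℤ) :=
    (mem_torsionLocalKer_iff_exists_h1Eval_eq_smul_sub W (n : ℤ) h𝔐 hF hI hopen hsurj hunr).mpr hx
  exact (mem_torsionLocalKer_iff_res_eq_zero W (v.adicCompletion K) hn0 x).mp htor

end Transverse

/-! ## §2 Level `4`: the local condition of order `≥ 8` as an annihilator -/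

section LevelFour

variable {K : Type} [Field K] [NumberField K] (W : WeierstrassCurve K) [W.IsElliptic] (v : HeightOneSpectrum (𝓞 K))
variable (e : geomTorsion W ((2 ^ 2 : ℕ) : ℤ) → geomTorsion W ((2 ^ 2 : ℕ) : ℤ) → AlgebraicClosure K)
  (hμ : ∀ S T, e S T ^ (2 ^ 2) = 1)
  (hadd₁ : ∀ S₁ S₂ T, e (S₁ + S₂) T = e S₁ T * e S₂ T)
  (hadd₂ : ∀ S T₁ T₂, e S (T₁ + T₂) = e S T₁ * e S T₂)
  (hgal : ∀ (σ : absoluteGaloisGroup K) (S T : geomTorsion W ((2 ^ 2 : ℕ) : ℤ)), σ • e S T = e (σ • S) (σ • T))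
  (halt : ∀ T, e T T = 1) (hnondeg : ∀ T, (∀ S, e S T = 1) → T = 0)
  (inv : LocalInvariants K (2 ^ 2))

include halt hnondeg in
/-- **The local condition at a deep own prime, ∃-form (level `4`, any number field).**  `v ∤ 2` a finite place of good
reduction with `#H¹(K_v, E[4]) = 16` and `inv_v` injective; `𝔐 ∈ v.localPrimesAbove`, `F ∈ Γ_K` an arithmetic Frobenius at the
prime of the chosen embedding.  Then there is **`M ≤ H¹(K_v, E[4])` with `8 ≤ #M`** such that for EVERY global `Z ∈ H¹(K, E[4])`
with `2•Z` TRANSVERSE at `F` (`[2•Z, F] ∈ (F − 1)E[4]`) and every `m ∈ M`: **`inv_v(loc_v(2•Z) ∪ₑ m) = 0`**.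
`M := X^⊥`, `X := loc_v(𝒯) ⊓ 2•H¹(K_v, E[4])`, `𝒯` the transverse classes; `#X ≤ 2` (module docstring).
[cite: McCallumLMS1991, §5 Lemma 5.3 and proof of Prop. 5.2 (13)] [cite: MilneADT2006, Ch. I, Cor. 2.3, Cor. 3.4] -/
theorem exists_localCondition_eight_le_of_frobenius (hv : W.HasGoodReductionAt v) (h2v : ((2 : ℕ) : 𝓞 K) ∉ v.asIdeal)
    (hinv : Injective (inv (Sum.inr v)))
    (hV : Nat.card (galoisCohomology ((W.torsionGaloisModule ((2 ^ 2 : ℕ) : ℤ)).toLocal (Sum.inr v)) 1) = 16)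
    {𝔐 : Ideal (HeightOneSpectrum.localAbsIntegers v)} (h𝔐 : 𝔐 ∈ v.localPrimesAbove)
    {F : absoluteGaloisGroup K}
    (hF : IsArithFrobAt (𝓞 K) F (v.primeBelow (closureEmb (K := K) (v.adicCompletion K)) 𝔐)) :
    ∃ M : AddSubgroup (galoisCohomology ((W.torsionGaloisModule ((2 ^ 2 : ℕ) : ℤ)).toLocal (Sum.inr v)) 1),
      8 ≤ Nat.card M ∧
      ∀ Z : galoisCohomology (W.torsionGaloisModule ((2 ^ 2 : ℕ) : ℤ)) 1,
        (∃ P : geomTorsion W ((2 ^ 2 : ℕ) : ℤ), h1Eval W _ ((2 : ℕ) • Z) F = F • P - P) →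
        ∀ m ∈ M, invWeilPairing W (2 ^ 2) e hμ hadd₁ hadd₂ hgal inv (Sum.inr v)
          (galoisCohomology.localization (W.torsionGaloisModule ((2 ^ 2 : ℕ) : ℤ)) (Sum.inr v) 1 ((2 : ℕ) • Z)) m = 0 := by
  classical
  haveI : CharZero (v.adicCompletion K) := charZero_adicCompletion v
  haveI : Fact (Nat.Prime 2) := ⟨Nat.prime_two⟩
  haveI hfin := finite_galoisCohomology_toLocal_inr W (2 ^ 2) v
  -- notation
  set V := galoisCohomology ((W.torsionGaloisModule ((2 ^ 2 : ℕ) : ℤ)).toLocal (Sum.inr v)) 1 with hVdef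
  set b := invWeilPairing W (2 ^ 2) e hμ hadd₁ hadd₂ hgal inv (Sum.inr v) with hb
  set loc := galoisCohomology.localization (W.torsionGaloisModule ((2 ^ 2 : ℕ) : ℤ)) (Sum.inr v) 1 with hloc
  set L := W.kummerSelmerStructure ((2 ^ 2 : ℕ) : ℤ) (Sum.inr v) with hL
  have hA : ∀ x : V, (2 ^ 2) • x = 0 := nsmul_galoisCohomology_toLocal_eq_zero W (2 ^ 2) (Sum.inr v)
  have hbij : Bijective b := invWeilPairing_bijective W (2 ^ 2) e hμ hadd₁ hadd₂ hgal hnondeg inv v hinv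
  have hflip : Bijective b.flip := invWeilPairing_flip_bijective W (2 ^ 2) e hμ hadd₁ hadd₂ hgal hnondeg inv v hinv
  -- the subgroup of transverse classes (w.r.t. `F`)
  let 𝒯 : AddSubgroup (galH1Torsion W ((2 ^ 2 : ℕ) : ℤ)) :=
    { carrier := {x | ∃ P : geomTorsion W ((2 ^ 2 : ℕ) : ℤ), h1Eval W _ x F = F • P - P}
      add_mem' := fun hx hy ↦ transverse_add W _ hx hy
      zero_mem' := transverse_zero W _ F
      neg_mem' := fun hx ↦ transverse_neg W _ hx }
  have h𝒯 : ∀ x, x ∈ 𝒯 ↔ ∃ P : geomTorsion W ((2 ^ 2 : ℕ) : ℤ), h1Eval W _ x F = F • P - P := fun x ↦ Iff.rfl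
  -- the doubles `D = 2•V` and `X = loc(𝒯) ⊓ D`
  set D : AddSubgroup V := (nsmulAddMonoidHom (2 : ℕ) : V →+ V).range with hD
  set X : AddSubgroup V := 𝒯.map loc ⊓ D with hX
  -- `X ⊓ L = ⊥`: transverse ∧ Kummer ⟹ zero
  have h2Z : ((((2 ^ 2 : ℕ) : ℤ)) : 𝓞 K) ∉ v.asIdeal := by
    rw [Int.cast_natCast, Nat.cast_pow]
    exact fun h ↦ h2v (v.isPrime.mem_of_pow_mem 2 h)
  have hXL : ∀ x ∈ X, x ∈ L → x = 0 := by
    rintro x ⟨⟨x', hx', rfl⟩, -⟩ hxL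
    exact localization_eq_zero_of_transverse_of_mem_kummer W (n := 2 ^ 2) (by norm_num) hv h2Z h𝔐 hF hx' hxL
  -- `D` is isotropic, hence `#D ≤ 4`
  have hDiso : ∀ d ∈ D, ∀ d' ∈ D, b d d' = 0 := by
    rintro _ ⟨a, rfl⟩ _ ⟨c, rfl⟩
    change b ((2 : ℕ) • a) ((2 : ℕ) • c) = 0
    have h4 : ∀ z : ZMod (2 ^ 2), (2 : ℕ) • (2 : ℕ) • z = 0 := by decide
    rw [map_nsmul, map_nsmul, AddMonoidHom.nsmul_apply, h4]
  have hDle : D ≤ annLeft b D := fun d hd d' hd' ↦ hDiso d hd d' hd'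
  have hD4 : Nat.card D ≤ 4 := by
    have hmul := natCard_annLeft_mul hA b hbij D
    have hle : Nat.card D ≤ Nat.card (annLeft b D) := AddSubgroup.card_le_of_le hDle
    rw [hV] at hmul
    have hsq : Nat.card D * Nat.card D ≤ 16 := by
      calc Nat.card D * Nat.card D ≤ Nat.card (annLeft b D) * Nat.card D := Nat.mul_le_mul_right _ hle
        _ = 16 := hmul
    by_contra hlt
    push Not at hlt
    have h25 : 5 * 5 ≤ Nat.card D * Nat.card D := Nat.mul_le_mul hlt hlt
    omega
  have hXD : X ≤ D := inf_le_right
  -- `#X ≤ 2`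
  have hX2 : Nat.card X ≤ 2 := by
    by_cases hcase : ∃ f ∈ L, (2 : ℕ) • f ≠ 0
    · -- an element `2•f ≠ 0` of `L ⊓ D`, `2`-torsion: the line `{0, 2•f}` meets `X` trivially inside `D`
      obtain ⟨f, hfL, hf2⟩ := hcase
      set L₂ : AddSubgroup V := AddSubgroup.zmultiples ((2 : ℕ) • f) with hL₂
      have hL₂D : L₂ ≤ D := AddSubgroup.zmultiples_le_of_mem ⟨f, rfl⟩
      have hL₂L : L₂ ≤ L := AddSubgroup.zmultiples_le_of_mem (L.nsmul_mem hfL 2)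
      have hord : addOrderOf ((2 : ℕ) • f) = 2 := by
        refine addOrderOf_eq_prime ?_ hf2
        rw [← mul_nsmul]; exact hA f
      have hL₂card : Nat.card L₂ = 2 := by rw [hL₂, Nat.card_zmultiples, hord]
      have hinf : X ⊓ L₂ = ⊥ := by
        rw [eq_bot_iff]
        rintro x ⟨hxX, hxL₂⟩
        rw [AddSubgroup.mem_bot]
        exact hXL x hxX (hL₂L hxL₂)
      have hsup : Nat.card ↥(X ⊔ L₂) ≤ 4 := (AddSubgroup.card_le_of_le (sup_le hXD hL₂D)).trans hD4
      have h := Literature.NumberTheory.GaloisRepresentations.natCard_sup_mul_natCard_inf X L₂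
      rw [hinf, AddSubgroup.card_bot, mul_one, hL₂card] at h
      omega
    · -- `2•L = 0`: then `D ≤ L^⊥ = L`, so `X ≤ L`, `X = ⊥`
      push Not at hcase
      have hEuler : Nat.card V = (Nat.card (nsmulAddMonoidHom (2 ^ 2) :
            (W.baseChange (v.adicCompletion K)).toAffine.Point →+ _).ker *
          Nat.card (v.adicCompletionIntegers K ⧸ Ideal.span {((2 ^ 2 : ℕ) : v.adicCompletionIntegers K)})) ^ 2 :=
        natCard_galoisCohomology_one_torsion_adicCompletion_eq_sq W v (2 ^ 2) ⟨2, 2, Nat.prime_two.prime, two_pos, rfl⟩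
          (localEulerPoincareCharacteristic_holds (v.adicCompletion K))
      have hLL : annRight b L = L :=
        annRight_invWeilPairing_kummer_eq W (2 ^ 2) e hμ hadd₁ hadd₂ hgal halt hnondeg inv v hinv hEuler
      have hDL : D ≤ L := by
        rintro _ ⟨a, rfl⟩
        rw [← hLL, mem_annRight_iff]
        intro f hf
        change b f ((2 : ℕ) • a) = 0
        rw [map_nsmul, ← AddMonoidHom.nsmul_apply, ← map_nsmul, hcase f hf, map_zero, AddMonoidHom.zero_apply]
      have hXbot : X = ⊥ := by
        rw [eq_bot_iff]
        intro x hx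
        rw [AddSubgroup.mem_bot]
        exact hXL x hx (hDL (hXD hx))
      rw [hXbot, AddSubgroup.card_bot]
      omega
  -- `M := X^⊥`, `#M · #X = #V = 16`
  refine ⟨annRight b X, ?_, ?_⟩
  · have hmul := natCard_annRight_mul hA b hflip X
    rw [hV] at hmul
    have hpos : 0 < Nat.card X := Nat.card_pos
    by_contra hlt
    push Not at hlt
    have : Nat.card (annRight b X) * Nat.card X < 8 * 2 := Nat.mul_lt_mul_of_lt_of_le hlt hX2 (by norm_num)
    omega
  · intro Z hZ m hm
    have hmem : loc ((2 : ℕ) • Z) ∈ X :=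
      ⟨⟨(2 : ℕ) • Z, (h𝒯 _).mpr hZ, rfl⟩, ⟨loc Z, (map_nsmul loc 2 Z).symm⟩⟩
    exact (mem_annRight_iff b X m).mp hm _ hmem

end LevelFour

/-! ## §3 Over `ℚ` at a Gross–Kolyvagin prime of index `≥ 2` (the hypotheses of the S-bot socket) -/

section Rat

variable (W : WeierstrassCurve ℚ) [W.IsElliptic] [W.IsGloballyMinimal]
variable (e : geomTorsion W ((2 ^ 2 : ℕ) : ℤ) → geomTorsion W ((2 ^ 2 : ℕ) : ℤ) → AlgebraicClosure ℚ)
  (hμ : ∀ S T, e S T ^ (2 ^ 2) = 1)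
  (hadd₁ : ∀ S₁ S₂ T, e (S₁ + S₂) T = e S₁ T * e S₂ T)
  (hadd₂ : ∀ S T₁ T₂, e S (T₁ + T₂) = e S T₁ * e S T₂)
  (hgal : ∀ (σ : absoluteGaloisGroup ℚ) (S T : geomTorsion W ((2 ^ 2 : ℕ) : ℤ)), σ • e S T = e (σ • S) (σ • T))
  (halt : ∀ T, e T T = 1) (hnondeg : ∀ T, (∀ S, e S T = 1) → T = 0)
  (inv : LocalInvariants ℚ (2 ^ 2))

include halt hnondeg in
/-- **The local condition at a deep own prime over `ℚ`, fixed Frobenius.**  `E/ℚ` with `Δ < 0`; `ℓ ≠ 2` a prime of good reduction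
with `Frob_ℓ = Frob_∞` on `E[2]` and `kolyvaginIndex ≥ 2` (so `#H¹(ℚ_ℓ, E[4]) = 16`, LEAD `natCard_galoisCohomology_one_toLocal_two_pow_eq`);
`v` its place, `inv_v` injective; `𝔐 ∈ v.localPrimesAbove` and `F` an arithmetic Frobenius at the prime of the chosen embedding.  Then
**`∃ M ≤ H¹(ℚ_ℓ, E[4])` with `8 ≤ #M`** killing `inv_ℓ(loc_ℓ(2•Z) ∪ₑ ·)` for every global `Z` with `[2•Z, F] ∈ (F − 1)E[4]`.  Feed `M`
as `M_u` at the deep own places of `…RTOrderFourAuxiliaryConstrained.exists_mem_kummerOutside_four_two_nsmul_ne_zero_of_free_of_eight_le`.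
[cite: McCallumLMS1991, §5 Lemma 5.3 and proof of Prop. 5.2 (13)] [cite: MilneADT2006, Ch. I, Cor. 2.3, Thm. 2.8] -/
theorem exists_localCondition_eight_le_rat (hΔ : W.Δ < 0) {K : Type} [Field K] [NumberField K]
    {ℓ : ℕ} [Fact ℓ.Prime] (hℓ2 : ℓ ≠ 2) (hgoodℓ : W.HasGoodReductionAtPrime ℓ) (hℓ : FrobEqFrobInfty W K 2 ℓ)
    {v : HeightOneSpectrum (𝓞 ℚ)} (hv : (ℓ : 𝓞 ℚ) ∈ v.asIdeal) (hidx : 2 ≤ Zhang2014.kolyvaginIndex W 2 ℓ)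
    (hinv : Injective (inv (Sum.inr v)))
    {𝔐 : Ideal (HeightOneSpectrum.localAbsIntegers v)} (h𝔐 : 𝔐 ∈ v.localPrimesAbove)
    {F : absoluteGaloisGroup ℚ}
    (hF : IsArithFrobAt (𝓞 ℚ) F (v.primeBelow (closureEmb (K := ℚ) (v.adicCompletion ℚ)) 𝔐)) :
    ∃ M : AddSubgroup (galoisCohomology ((W.torsionGaloisModule ((2 ^ 2 : ℕ) : ℤ)).toLocal (Sum.inr v)) 1),
      8 ≤ Nat.card M ∧
      ∀ Z : galoisCohomology (W.torsionGaloisModule ((2 ^ 2 : ℕ) : ℤ)) 1,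
        (∃ P : geomTorsion W ((2 ^ 2 : ℕ) : ℤ), h1Eval W _ ((2 : ℕ) • Z) F = F • P - P) →
        ∀ m ∈ M, invWeilPairing W (2 ^ 2) e hμ hadd₁ hadd₂ hgal inv (Sum.inr v)
          (galoisCohomology.localization (W.torsionGaloisModule ((2 ^ 2 : ℕ) : ℤ)) (Sum.inr v) 1 ((2 : ℕ) • Z)) m = 0 := by
  have hgood : W.HasGoodReductionAt v := W.hasGoodReductionAt_of_hasGoodReductionAtPrime v hv hgoodℓ
  have h2v : ((2 : ℕ) : 𝓞 ℚ) ∉ v.asIdeal := LocalDualityOrder.two_notMem_of_odd_prime_mem hℓ2 hv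
  have hV : Nat.card (galoisCohomology ((W.torsionGaloisModule ((2 ^ 2 : ℕ) : ℤ)).toLocal (Sum.inr v)) 1) = 16 := by
    rw [natCard_galoisCohomology_one_toLocal_two_pow_eq W hΔ hℓ2 hgoodℓ hℓ hv two_ne_zero hidx]; norm_num
  exact exists_localCondition_eight_le_of_frobenius W v e hμ hadd₁ hadd₂ hgal halt hnondeg inv hgood h2v hinv hV h𝔐 hF

include halt hnondeg in
/-- **The local condition at a deep own prime over `ℚ`, `∀`-Frobenius form** (the transversality hypothesis on `2•Z` quantified
as in gk2-p3's I7 `…RTTransverseIsotropicInv.invWeilPairing_localization_eq_zero_of_transverse_of_Δ_neg`: over EVERY prime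
`𝔓 ∣ v`, every arithmetic Frobenius `F` there and every complex conjugation `c₀` with `F = c₀` on `E[4]`).  Needs `Frob_ℓ = Frob_∞` on
`E[4]` (`FrobEqFrobInfty W K 4 ℓ`, which also gives the level-`2` hypothesis and, through `natCard_galoisCohomology_one_toLocal_two_pow_eq`,
`#H¹(ℚ_ℓ, E[4]) = 16`); the Frobenius at the prime of the chosen embedding is supplied by `FrobEqFrobInfty.exists_at`.
[cite: McCallumLMS1991, §5 Lemma 5.3 and proof of Prop. 5.2 (13)] [cite: GrossLMS1991, §3 (3.2)] -/
theorem exists_localCondition_eight_le_forall (hΔ : W.Δ < 0) {K : Type} [Field K] [NumberField K]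
    {ℓ : ℕ} [Fact ℓ.Prime] (hℓ2 : ℓ ≠ 2) (hgoodℓ : W.HasGoodReductionAtPrime ℓ) (hℓ4 : FrobEqFrobInfty W K (2 ^ 2) ℓ)
    {v : HeightOneSpectrum (𝓞 ℚ)} (hv : (ℓ : 𝓞 ℚ) ∈ v.asIdeal) (hidx : 2 ≤ Zhang2014.kolyvaginIndex W 2 ℓ)
    (hinv : Injective (inv (Sum.inr v))) :
    ∃ M : AddSubgroup (galoisCohomology ((W.torsionGaloisModule ((2 ^ 2 : ℕ) : ℤ)).toLocal (Sum.inr v)) 1),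
      8 ≤ Nat.card M ∧
      ∀ Z : galoisCohomology (W.torsionGaloisModule ((2 ^ 2 : ℕ) : ℤ)) 1,
        (∀ 𝔓 ∈ v.primesAbove, ∀ F c₀ : absoluteGaloisGroup ℚ, IsArithFrobAt (𝓞 ℚ) F 𝔓 →
          IsComplexConjugation (Rat.castHom ℝ) c₀ → (∀ P : geomTorsion W ((2 ^ 2 : ℕ) : ℤ), F • P = c₀ • P) →
          ∃ P₁ : geomTorsion W ((2 ^ 2 : ℕ) : ℤ), h1Eval W _ ((2 : ℕ) • Z) F = F • P₁ - P₁) →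
        ∀ m ∈ M, invWeilPairing W (2 ^ 2) e hμ hadd₁ hadd₂ hgal inv (Sum.inr v)
          (galoisCohomology.localization (W.torsionGaloisModule ((2 ^ 2 : ℕ) : ℤ)) (Sum.inr v) 1 ((2 : ℕ) • Z)) m = 0 := by
  have hℓp : ℓ.Prime := Fact.out
  have hℓ : FrobEqFrobInfty W K 2 ℓ := FrobEqFrobInfty.of_dvd (W := W) (K := K) (m := 2) (n := 2 ^ 2) ⟨2, by norm_num⟩ hℓ4
  obtain ⟨𝔐, h𝔐⟩ := v.localPrimesAbove_nonempty
  set 𝔓 := v.primeBelow (closureEmb (K := ℚ) (v.adicCompletion ℚ)) 𝔐 with h𝔓def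
  have h𝔓 : 𝔓 ∈ v.primesAbove := HeightOneSpectrum.primeBelow_mem_primesAbove h𝔐
  obtain ⟨F, c₀, hFrob, hc₀, hE, -⟩ := FrobEqFrobInfty.exists_at (W := W) (K := K) hℓp hℓ4 hv h𝔓
  obtain ⟨M, hM8, hM⟩ := exists_localCondition_eight_le_rat W e hμ hadd₁ hadd₂ hgal halt hnondeg inv hΔ hℓ2 hgoodℓ hℓ hv hidx
    hinv h𝔐 hFrob
  exact ⟨M, hM8, fun Z hZ m hm ↦ hM Z (hZ 𝔓 h𝔓 F c₀ hFrob hc₀ hE) m hm⟩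

end Rat

end Summit.BirchSwinnertonDyer.BirchSwinnertonDyer.Theorems.GenusExact.DeepOwnPrime

end
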